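import Summits.QuantumAdvantage.QuantumAdvantage.Theses.KummerSector
import Literature.NumberTheory.GaussSums.KummerClassesEquidistributionProofs
import Literature.Computability.Complexity.Oracle

/-!
# Birth skeleton — crux `vanDamSeroussi2002` of route `KummerSector` (stmt-QuantumAdvantage-14587)

The crux (rank 5 of route-QuantumAdvantage-KummerSector; the declared CONDITION of that conditional
bridge, hypothesis-type) is W = "Kummer's trit is not `BPP`-computable":

  `vanDamSeroussi2002 := ¬ (L_I ∈ BPP ∧ L_II ∈ BPP ∧ L_III ∈ BPP)`,

`L_I = {p ≡ 1 (3) prime : √p < G_p}` (= `KS`), `L_II = {−√p < G_p < √p}`, `L_III = {G_p < −√p}`,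
`G_p = Σ_{x<p} cos(2πx³/p)` (`= Literature.NumberTheory.GaussSums.kummerSum p`, definitionally) —
van Dam–Seroussi 2002 §8 ("important open question if Gauss sum estimation is hard classically") in
the cubic prime-field case. With `L_I, L_II, L_III ∈ BQP ⊆ PSPACE` it forces `P ≠ PSPACE`
(`Literature.Barriers.QuantumAdvantage.SeparationPrerequisites`), so every line for it ends in a
hypothesis-type apex; what a line can EARN is the reduction theory around the apex (the genre of the
registered skeletons of `IqThreeNotBPP` and `LiouvilleNotPPoly`).

## The line: ALGEBRAIC QUANTISATION — "the trit is the whole estimation problem"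

van Dam–Seroussi pose HARDNESS OF ESTIMATION: compute the phase of the Gauss sum to precision `ε`
(§2.2 Def. 2, §8). For the cubic character of `𝔽_p` the sum is pinned by algebra to three candidates:
`G_p` is a root of Kummer's period cubic `f = X³ − 3pX − Ap`, `4p = A² + 27B²`, `A ≡ 1 (3)`
(tree: `KummerClasses.kummerSum_root_periodCubic`, IR Ch. 9 §12), whose three real roots lie one in
each of Kummer's intervals `(−2√p,−√p)`, `(−√p,√p)`, `(√p,2√p)` and are each at distance `≥ 1` from
`±√p` (from `(2√p − A)(2√p + A) = 27B² ≥ 27`); `f` has no rational root. Hence Kummer's 1.58-bit trit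
plus the classical norm form `A` decide EVERY rational threshold `a/b < G_p` by ONE integer sign
evaluation (`thresholdRule`): coarse = fine. The skeleton cuts W along this seam into

* T  `stub_thresholdNotBPP` (APEX, hypothesis-type): the KUMMER-SUM THRESHOLD LANGUAGE
  `KT = {⟨p, ⟨a, b⟩⟩ : p ≡ 1 (3) prime, b > 0, a/b < G_p}` is not in `BPP` — estimation of the
  cubic Gauss sum `g(χ_p)` (`G_p = 2 Re g`, `|g| = √p`) to polynomially many bits is classically
  hard: vDS §8 verbatim for the cubic character of `𝔽_p`, in decision form. Never staffed for proof.
  Sources: VanDamSeroussi2002 §8 p.12, §2.2 Def. 2; classical record `O(p^{1/2+ε})` (direct /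
  baby-step–giant-step), Matthews1979 (elliptic product with `(p−1)/3` factors), CosgraveDilcher2011.
* R₁ `stub_thresholdRule` (provable, M–L; real algebra of the period cubic): if `4p = A² + 27B²` and
  `G_p` is a root of `X³ − 3pX − Ap` then `a/b < G_p ↔ thresholdRule p A a b (kummerClass p)`.
  Plan: `f` is increasing on `(−∞,−√p]`, decreasing on `[−√p,√p]`, increasing on `[√p,∞)`
  (`f(x) − f(y) = (x−y)(x²+xy+y²−3p)`); `f(√p) = −p(2√p+A) < 0 < p(2√p−A) = f(−√p)`; each root is
  `≥ 1` away from `±√p` (if `r = √p + δ`, `|δ| < 1`, then `|3√pδ² + δ³| < 3√p + 1 < 27√p/4 ≤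
  p(2√p + A)`, absurd); a rational root would be an integer `m` with `p ∣ m`, whence `p ∣ A`,
  `p ∣ B`, `p² ∣ 4p`; so `s = ⌊√p⌋ + 1/2 ∈ (r_II, r_I)`, `−s ∈ (r_III, r_II)` and the sign of
  `N = b³ f(a/b)` decides. Leans on: `Nat.sqrt_le'`, `Nat.lt_succ_sqrt'`, `Real.sqrt` API.
  Sources: IrelandRosen1990 Ch. 9 §12 (Lemma 2, Corollary, Ex. 43).
* R₂ `stub_thresholdReducesToTrit` (provable, XL; algorithmic number theory): granting R₁,
  `KT ∈ BPPRel kummerTritOracle` — randomized polynomial time with ONE query to Kummer's trit (the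
  list oracle of the three class languages). Plan: decode `⟨p, a, b⟩`, reject off `p ≡ 1 (3)` prime
  (AKS, tree `AKSMachineFP`) or `b = 0`; a random cubic non-residue `c` from the coin string
  (density `2/3`; `|x|` trials), `u = c^{(p−1)/3}` a primitive cube root of unity, `r = 2u + 1`,
  `r² ≡ −3 (mod p)`; Euclid in the norm-Euclidean ring `ℤ[ω]` gives the prime `π = gcd(p, u − ω)` of
  norm `p`; make `π = a₀ + b₀ω` primary (`a₀ ≡ 2`, `b₀ ≡ 0 (3)`, IR Prop. 9.3.5) and put
  `A = 2a₀ − b₀`, `B = b₀/3` (`4p = A² + 27B²`, `A ≡ 1 (3)`); this `A` is THE norm form of the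
  tree's `kummerSum_root_periodCubic` by uniqueness of `A ≡ 1 (3)` in `4p = A² + 27B²`
  (`𝓞 ℚ(ζ₃)` is a PID — Mathlib `NumberTheory/Cyclotomic/PID`; `2` is inert), so R₁ applies with
  `kummerSum p ^ 3 − 3p·kummerSum p − A p = 0`; query the oracle at `bin p` for the class; output
  the rule's bit. A `bp (PRel _)` witness in the tree's `CodeFP`/`Brick` algebra; error
  `≤ (1/3 + 2^{−|x|})^{|x|}` on the promise, `0` off it.
  Sources: Cornacchia 1908 / Euclid in `ℤ[ω]` (IrelandRosen1990 Ch. 1 §4, Ch. 9 §§3–4),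
  AdlemanMandersMiller1977 / TonelliShanks (random non-residues), AKS 2004.
* C  `stub_bppListOracleClosure` (known theorem, L in the tree): `BPP^{BPP} = BPP` for finitely many
  `BPP` oracle languages presented as one list oracle: `(∀ L ∈ Ls, L ∈ BPP) → BPPRel (listOracle Ls)
  ⊆ BPP`. Plan: simulate the list oracle by the language oracle of the join (`k` one-bit queries per
  list query; `OracleAlg.PRel_subset_PRel_of_mem_FPRel`), the join of `BPP` languages is `BPP`
  (error-reduce each, shared coin prefix), `bp (PRel (ofLanguage J))` with `J ∈ BPP` is `BPP` by the
  adaptive normal form `AdQuery.exists_eq_adLang_of_mem_PRel` and the union-bound simulation of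
  `AdBPPSim` (`exists_accF_good`, `adLang_mem_BPP` is the deterministic case `P^{BPP} = BPP`) after
  reducing the outer `bp` error to `1/4`. Sources: Ko 1982 (BPP is low for BPP), Zachos 1988,
  AroraBarak2009 §7.5.2 ("`BPP^{BPP} = BPP`").

Composition `vanDamSeroussi2002_of` (no sorry, 2 lines): were all three class languages in `BPP`,
the trit oracle would be a list of `BPP` languages, so `KT ∈ BPP^{trit}` (R₂ ∘ R₁) `⊆ BPP` (C),
contradicting T.

## Honest status (calibration)

T is EQUIVALENT to W modulo R₁, R₂, C and tree closure: conversely `W → T`, since `L_I` is the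
`FP`-preimage of `KT` under `p ↦ ⟨p, 2⌊√p⌋ + 1, 2⟩` (class I `↔ G_p > ⌊√p⌋ + 1/2`, by the root
separation), `L_III` a complemented preimage, `L_II` the rest (`preimage_mem_BPP`, `co_BPP_holds`).
So, exactly as for `LiouvilleNotPPoly` v3, the line is a DECOMPOSITION of W into (estimation
hardness, the form in which the literature poses and attacks it) + (the quantisation theorem R₁/R₂:
Kummer's trit already carries all polynomial-precision information about `g(χ_p)` — the mechanism
the whole route rests on, shared with the classical post-processing of `KsMemBQP` /
`KsLowerClassesMemBQP`) + (closure C); it is not a reduction of W to a weaker or standard hypothesis —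
none is known (vDS §5.1 Lemma 2 needs a full-order character; the trit is invisible at every finite
place, being the archimedean sector of `g`). What the line EARNS when R₁, R₂, C land: the refutation
floor "a classical trit algorithm is a classical poly-precision evaluation of every cubic Gauss sum
over `𝔽_p`" and, contrapositively, that ANY classical estimation speed-up (e.g. a Chowla–Mordell-type
evaluation of Matthews' elliptic third-set product) kills W through T.

## Disproof used

None exists for this crux (`ledger crux ls stmt-QuantumAdvantage-14587`, 2026-08-17: no workfiles —
no `Disproof.lean`, no `Theorems/vanDamSeroussi2002/Negative/*`). Negatives index (`ledger negatives
--problem QuantumAdvantage`, 6 refuted statements: RegulatorThird, ShorLocallyDark, CubicForrelation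
CubicStability, SpinorFlattening GaussRankPoly, KummerSector KsNotFrobenian (stmt-1615: zero-polynomial
Frobenian-table witness), SeparableFrames): none concerns threshold estimation of `G_p`, oracle
reductions or `BPP` closure, so no stub restates a refuted statement.

## BC3 probes (folder `bc/stub_<Stmt>_probe.lean`, statements inlined, no stub/composition in scope)

For each of the four stub statements `X` and each target `Y ∈ {vanDamSeroussi2002, QuantumAdvantage}`:
`example : X → Y` by `first | exact? | simpa | aesop` and by the extended BC2 combinator
`first | exact? | simpa [X, Y] | (unfold X Y; simpa) | aesop` FAIL (exact?: could not close the goal;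
simpa: failed; aesop: failed after exhaustive search); the converses `Y → X` FAIL likewise; the dedup
probe `example : X := by exact?` FAILS. 28/28 failures: no stub is cheaply the crux or the summit, none
is a tree theorem.

`lean check --json`: rc 0, errors [], sorries 4 = {stub_thresholdNotBPP, stub_thresholdRule,
stub_thresholdReducesToTrit, stub_bppListOracleClosure}; zero `sorry` elsewhere; the composition
concludes `Summit.QuantumAdvantage.QuantumAdvantage.Theses.KummerSector.vanDamSeroussi2002` BY NAME.
-/

set_option linter.dupNamespace false

noncomputable section

namespace Summit.QuantumAdvantage.QuantumAdvantage.Cruxes.vanDamSeroussi2002.Birth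

open _root_.Computability
open Literature.Computability.Complexity
open Literature.NumberTheory.GaussSums (kummerSum)

/-! ### Vocabulary -/

/-- Kummer's CLASS I language `L_I = {p ≡ 1 (3) prime : √p < G_p}`, `G_p = Σ_{x<p} cos(2πx³/p)` —
verbatim the first language of the crux (`= KS` of `KsThesis`/`KsMemBQP`/`KsClassical`).
[cite: IrelandRosen1990, Ch. 9 §12 (three intervals)] -/
def classI : Language Bool :=
  Computability.encodingNatBool.toLanguage {p : ℕ | p.Prime ∧ p % 3 = 1 ∧ Real.sqrt (p : ℝ) < ∑ x ∈ Finset.range p, Real.cos (2 * Real.pi * (x : ℝ) ^ 3 / (p : ℝ))}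

/-- Kummer's CLASS II language `L_II = {p ≡ 1 (3) prime : -√p < G_p < √p}` — verbatim the second
language of the crux. [cite: IrelandRosen1990, Ch. 9 §12] -/
def classII : Language Bool :=
  Computability.encodingNatBool.toLanguage {p : ℕ | p.Prime ∧ p % 3 = 1 ∧ -Real.sqrt (p : ℝ) < ∑ x ∈ Finset.range p, Real.cos (2 * Real.pi * (x : ℝ) ^ 3 / (p : ℝ)) ∧ ∑ x ∈ Finset.range p, Real.cos (2 * Real.pi * (x : ℝ) ^ 3 / (p : ℝ)) < Real.sqrt (p : ℝ)}

/-- Kummer's CLASS III language `L_III = {p ≡ 1 (3) prime : G_p < -√p}` — verbatim the third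
language of the crux. [cite: IrelandRosen1990, Ch. 9 §12] -/
def classIII : Language Bool :=
  Computability.encodingNatBool.toLanguage {p : ℕ | p.Prime ∧ p % 3 = 1 ∧ ∑ x ∈ Finset.range p, Real.cos (2 * Real.pi * (x : ℝ) ^ 3 / (p : ℝ)) < -Real.sqrt (p : ℝ)}

/-- The LIST ORACLE of finitely many languages: the query `q` is answered by the string of
indicator bits `[q ∈ L]_{L ∈ Ls}` (an `Oracle` in the sense of the tree: a total string function).
[cite: AroraBarak2009, §3.4 (oracle machines)] -/
def listOracle (Ls : List (Language Bool)) : Oracle :=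
  fun q => Ls.map fun L => L.boolIndicator q

/-- KUMMER'S TRIT as an oracle: the query `bin p` is answered by the three bits
`[p ∈ L_I], [p ∈ L_II], [p ∈ L_III]` (for `p ≡ 1 (3)` prime exactly one is `1`,
`kummerSum_trichotomy`). -/
def kummerTritOracle : Oracle :=
  listOracle [classI, classII, classIII]

/-- The KUMMER-SUM THRESHOLD relation: triples `(p, a, b)` with `p ≡ 1 (3)` prime, `b > 0` and
`a / b < G_p = kummerSum p` ("the rational `a/b` lies below the Kummer sum"). -/
def thresholdSet : Set (ℕ × ℤ × ℕ) :=
  {t | t.1.Prime ∧ t.1 % 3 = 1 ∧ 0 < t.2.2 ∧ (t.2.1 : ℝ) < t.2.2 * kummerSum t.1}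

/-- The KUMMER-SUM THRESHOLD LANGUAGE `KT = {⟨p, ⟨a, b⟩⟩ : p ≡ 1 (3) prime, b > 0, a/b < G_p}` over
`{0,1}` (binary naturals, signed integers and the pairing of `BoolEncodings`): deciding it on all
polynomial-size rationals `a/b` is ESTIMATING `G_p = 2 Re g(χ_p)` — equivalently the cubic Gauss sum
`g(χ_p)`, `|g| = √p` — to polynomially many bits: van Dam–Seroussi's Gauss-sum ESTIMATION problem for
the cubic character of `𝔽_p` in decision form. [cite: VanDamSeroussi2002, §2.2 Def. 2 and §8] -/
def KummerThreshold : Language Bool :=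
  (encodingNatBool.pairBool (encodingIntBool.pairBool encodingNatBool)).toLanguage thresholdSet

/-- Kummer's class of `p` as an index: `0` for class I (`√p < G_p`), `1` for class II, `2` for class
III (read off the order statistics used by the three languages; for `p ≡ 1 (3)` prime the boundary
values `G_p = ±√p` do not occur). -/
def kummerClass (p : ℕ) : ℕ :=
  if Real.sqrt p < kummerSum p then 0 else if -Real.sqrt p < kummerSum p then 1 else 2

/-- THE THRESHOLD RULE (computable integer arithmetic). Input: `p`, the norm-form integer `A`
(`4p = A² + 27B²`), a rational `a/b` (`b > 0`) and a class index `k`. With `s = ⌊√p⌋ + 1/2`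
(so `2s = 2⌊√p⌋ + 1`) and `N = a³ − 3p·a·b² − A·p·b³ = b³·f(a/b)` for Kummer's period cubic
`f = X³ − 3pX − Ap`, output
* class I  (`k = 0`): `[a/b < s] ∨ [N < 0]`;
* class II (`k = 1`): `[a/b ≤ −s] ∨ ([a/b < s] ∧ [N > 0])`;
* class III (else):  `[a/b < −s] ∧ [N < 0]`.
Rationale: `±s` separate the three real roots `r_III < −√p < r_II < √p < r_I` of `f` (each root is
at distance `≥ 1` from `±√p`, while `|s − √p| ≤ 1/2`), `f` has no rational root, and the signs of `f`
on `(−∞,r_III)`, `(r_III,r_II)`, `(r_II,r_I)`, `(r_I,∞)` are `−, +, −, +`; `G_p` is the root in Kummer's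
interval number `k`. -/
def thresholdRule (p : ℕ) (A a : ℤ) (b k : ℕ) : Bool :=
  let s2 : ℤ := 2 * (Nat.sqrt p : ℤ) + 1
  let N : ℤ := a ^ 3 - 3 * (p : ℤ) * a * (b : ℤ) ^ 2 - A * (p : ℤ) * (b : ℤ) ^ 3
  match k with
  | 0 => decide (2 * a < (b : ℤ) * s2) || decide (N < 0)
  | 1 => decide (2 * a ≤ -((b : ℤ) * s2)) || (decide (2 * a < (b : ℤ) * s2) && decide (0 < N))
  | _ => decide (2 * a < -((b : ℤ) * s2)) && decide (N < 0)

/-! ### The four stub statements (named; the composition is keyed by stub name) -/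

/-- STUB T (apex, hypothesis-type): the Kummer-sum threshold language is not in `BPP` —
"cubic Gauss sum ESTIMATION over prime fields is classically hard" [VanDamSeroussi2002, §8]. -/
def ThresholdNotBPP : Prop :=
  KummerThreshold ∉ BPP

/-- STUB R₁ (real algebra of the period cubic, provable): whenever `4p = A² + 27B²` and `G_p` is a
root of `X³ − 3pX − Ap`, the threshold rule fed with Kummer's class of `p` decides every rational
threshold exactly: `a/b < G_p ↔ thresholdRule p A a b (kummerClass p)`. -/
def ThresholdRuleCorrect : Prop :=
  ∀ (p : ℕ) (A B a : ℤ) (b : ℕ), p.Prime → p % 3 = 1 → 4 * (p : ℤ) = A ^ 2 + 27 * B ^ 2 →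
    kummerSum p ^ 3 - 3 * p * kummerSum p - A * p = 0 → 0 < b →
      ((a : ℝ) < b * kummerSum p ↔ thresholdRule p A a b (kummerClass p) = true)

/-- STUB R₂ (algorithmic number theory, provable): granting the threshold rule, the threshold
language is decided in randomized polynomial time with ONE query to Kummer's trit:
`KT ∈ BPP^{trit}` (the norm form `A` by Euclid in `ℤ[ω]` from a square root of `−3 mod p`, itself
from a random cubic non-residue; then the rule). -/
def ThresholdReducesToTrit : Prop :=
  ThresholdRuleCorrect → KummerThreshold ∈ BPPRel kummerTritOracle

/-- STUB C (structural complexity, known: `BPP^{BPP} = BPP`, Ko 1982): bounded-error randomized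
polynomial time relative to finitely many `BPP` languages (presented as one list oracle) is `BPP`. -/
def BPPListOracleClosure : Prop :=
  ∀ Ls : List (Language Bool), (∀ L ∈ Ls, L ∈ BPP) → BPPRel (listOracle Ls) ⊆ BPP

/-! ### The stubs (the ONLY sorries of the file) -/

/-- STUB T — `KummerThreshold ∉ BPP` (apex; hypothesis-type, = vDS §8 for the cubic character of
`𝔽_p` in estimation/decision form; never staffed for proof — it implies `P ≠ PSPACE`). -/
theorem stub_thresholdNotBPP : ThresholdNotBPP := by
  sorry

/-- STUB R₁ — correctness of the threshold rule (provable, size M–L: monotonicity of the period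
cubic on `(−∞,−√p]`, `[−√p, √p]`, `[√p, ∞)`; every root is at distance `≥ 1` from `±√p` by
`(2√p − A)(2√p + A) = 27B² ≥ 27`; no rational root; `⌊√p⌋ ≤ √p < ⌊√p⌋ + 1`). -/
theorem stub_thresholdRule : ThresholdRuleCorrect := by
  sorry

/-- STUB R₂ — `ThresholdRuleCorrect → KummerThreshold ∈ BPPRel kummerTritOracle` (provable, size XL:
a `bp (PRel _)` witness; random cubic non-residue `c` from the coins, `u = c^{(p−1)/3}`, `r = 2u+1`,
`r² ≡ −3`; Euclid in the norm-Euclidean `ℤ[ω]` for `π = gcd(p, u − ω)`, primary normalisation,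
`A = 2a − b`; uniqueness of `A ≡ 1 (3)` in `4p = A² + 27B²` (`𝓞 ℚ(ζ₃)` is a PID, Mathlib) to match
the tree's `kummerSum_root_periodCubic`; one oracle query `bin p`; the rule). -/
theorem stub_thresholdReducesToTrit : ThresholdReducesToTrit := by
  sorry

/-- STUB C — `BPP^{BPP} = BPP` for a list of `BPP` oracle languages (known theorem, size L in the
tree: error reduction `BPP_subset_bpErr_two_pow`, union bound over the polynomially many queries of
the `PRel` machine as in `AdBPPSim.adLang_mem_BPP`, the join of the list simulated by one language). -/
theorem stub_bppListOracleClosure : BPPListOracleClosure := by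
  sorry

/-! ### Name-keyed aliases of the stub statements (hypotheses of the composition, A12 audit) -/

namespace Registered

/-- Alias of stub T's statement keyed by the registered stub name. -/
abbrev stub_thresholdNotBPP : Prop := ThresholdNotBPP

/-- Alias of stub R₁'s statement keyed by the registered stub name. -/
abbrev stub_thresholdRule : Prop := ThresholdRuleCorrect

/-- Alias of stub R₂'s statement keyed by the registered stub name. -/
abbrev stub_thresholdReducesToTrit : Prop := ThresholdReducesToTrit

/-- Alias of stub C's statement keyed by the registered stub name. -/
abbrev stub_bppListOracleClosure : Prop := BPPListOracleClosure

end Registered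

/-! ### Sorry-free glue -/

/-- Membership in the class-I language is the class-I condition on the Kummer sum `G_p = kummerSum p`
(the tree's name for the crux's inline cosine sum; definitional). [folklore] -/
theorem encodeNat_mem_classI_iff (p : ℕ) :
    encodeNat p ∈ classI ↔ p.Prime ∧ p % 3 = 1 ∧ Real.sqrt p < kummerSum p :=
  Computability.encodingNatBool.mem_toLanguage_iff _ p

/-- Membership in the class-II language. [folklore] -/
theorem encodeNat_mem_classII_iff (p : ℕ) :
    encodeNat p ∈ classII ↔ p.Prime ∧ p % 3 = 1 ∧ -Real.sqrt p < kummerSum p ∧ kummerSum p < Real.sqrt p :=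
  Computability.encodingNatBool.mem_toLanguage_iff _ p

/-- Membership in the class-III language. [folklore] -/
theorem encodeNat_mem_classIII_iff (p : ℕ) :
    encodeNat p ∈ classIII ↔ p.Prime ∧ p % 3 = 1 ∧ kummerSum p < -Real.sqrt p :=
  Computability.encodingNatBool.mem_toLanguage_iff _ p

/-- The trit oracle answers `bin p` with the three class bits. [folklore] -/
theorem kummerTritOracle_apply (q : List Bool) :
    kummerTritOracle q = [classI.boolIndicator q, classII.boolIndicator q, classIII.boolIndicator q] :=
  rfl

/-- Membership in the threshold language of an encoded triple. [folklore] -/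
theorem encode_mem_KummerThreshold_iff (p : ℕ) (a : ℤ) (b : ℕ) :
    (encodingNatBool.pairBool (encodingIntBool.pairBool encodingNatBool)).encode (p, a, b) ∈ KummerThreshold ↔
      p.Prime ∧ p % 3 = 1 ∧ 0 < b ∧ (a : ℝ) < b * kummerSum p :=
  Computability.Encoding.mem_toLanguage_iff _ _ _

/-- The crux's hypothesis, read as a list: all three class languages are in `BPP`. [folklore] -/
theorem forall_mem_classes_of_and (h : classI ∈ BPP ∧ classII ∈ BPP ∧ classIII ∈ BPP) :
    ∀ L ∈ [classI, classII, classIII], L ∈ BPP := by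
  intro L hL
  simp only [List.mem_cons, List.not_mem_nil, or_false] at hL
  rcases hL with rfl | rfl | rfl
  · exact h.1
  · exact h.2.1
  · exact h.2.2

/-! ### Kernel-checked composition -/

/-- COMPOSITION (real proof, no sorry): the four stubs give the crux `vanDamSeroussi2002` BY NAME.
If all three of Kummer's class languages were in `BPP` (the negation of the crux), the trit oracle
would be a list of `BPP` languages; the threshold language is in `BPP^{trit}` (R₂, fed with R₁), hence
in `BPP` (C) — contradicting T. -/
theorem vanDamSeroussi2002_of (h₁ : Registered.stub_thresholdNotBPP) (h₂ : Registered.stub_thresholdRule)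
    (h₃ : Registered.stub_thresholdReducesToTrit) (h₄ : Registered.stub_bppListOracleClosure) :
    Summit.QuantumAdvantage.QuantumAdvantage.Theses.KummerSector.vanDamSeroussi2002 := by
  intro hall
  exact h₁ (h₄ [classI, classII, classIII] (forall_mem_classes_of_and hall) (h₃ h₂))

/-- Consistency check only (an `example`, so no sorry-tainted proof of the crux enters the
environment): the composition typechecks against the stubs exactly as stated. -/
example : Summit.QuantumAdvantage.QuantumAdvantage.Theses.KummerSector.vanDamSeroussi2002 :=
  vanDamSeroussi2002_of stub_thresholdNotBPP stub_thresholdRule stub_thresholdReducesToTrit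
    stub_bppListOracleClosure

/-! ### Sanity of the computable rule at `p = 7` (`A = 1`, `G_7 = 1 + 6 cos(2π/7) ≈ 4.74`, class I) -/

example : thresholdRule 7 1 4 1 0 = true := by native_decide
example : thresholdRule 7 1 5 1 0 = false := by native_decide
example : thresholdRule 7 1 19 4 0 = false := by native_decide
example : thresholdRule 7 1 (-9) 2 0 = true := by native_decide

end Summit.QuantumAdvantage.QuantumAdvantage.Cruxes.vanDamSeroussi2002.Birth

end
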